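import Mathlib
import Summits.NavierStokesRegularity.NavierStokesRegularity.Theses.OrthantWake
import HarnessLib

/-!
# `OrthantWake.OrthantInvariance` — Kamke cone invariance for the viscous lattice of an orthant
table (item stmt-NavierStokesRegularity-24642)

**Statement (verbatim route decl).** For `ε₀, ν > 0` and a table `α` satisfying the semantic Kamke
(quasi-positivity) condition on the cone `{Y : Y_{j,k} ≥ 0 for k ≥ 1}` — i.e. `Y ≥ 0` on shells
`≥ 1` and `Y_{i,n} = 0` (`n ≥ 1`) force `quadTerm δ α Y i n ≥ 0` — every regular solution `X` of
the `ν`-viscous lattice `X' = quadTerm ε₀ α X − ν (1+ε₀)^{2k} X` on a window `[0,s]`, issued from a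
one-shell datum at shell `0`, vanishing below shell `0`, continuous, and obeying the weighted a
priori bound `(1 + (1+ε₀)^{10k}) |X_{i,k}(t)| ≤ M`, is componentwise `≥ 0` on every shell `k ≥ 1`
for all `t ∈ [0,s]`.

PROOF (Kamke's argument made quantitative, for an infinite system). Two ingredients.

* A LIPSCHITZ-TYPE LOWER BOUND (`orthantInvariance_quadTerm_lower`): if at some time the negative
  parts of all modes on shells `≥ 1` are `≤ B` and `X_{i,k} ≤ 0` (`k ≥ 1`), then
  `quadTerm ε₀ α X i k ≥ −K·B` with `K = (Σ|α|)·2·(1+ε₀)^{10}·M` INDEPENDENT of `k`: compare `X`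
  with its projection `Y` onto the cone (positive parts on shells `≥ 1`), for which Kamke gives
  `quadTerm ε₀ α Y i k ≥ 0`; each bilinear term differs by `≤ |α|·2·B·((1+ε₀)^{5k/2}·|partner|)`,
  and the partner mode sits on a shell `≥ k − 1`, where the weight bound gives
  `(1+ε₀)^{5k/2} |partner| ≤ (1+ε₀)^{10} M`.
* A WINDOW STEP (`orthantInvariance_window`): on a window `[a,b]` with `K (b − a) ≤ ½` that starts
  in the cone, let `B` be the supremum of the negative parts over the window (finite by the a
  priori bound). For a mode negative at time `v`, go back to the last time `t₀ ∈ [a,v)` where it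
  was `≥ 0`; on `(t₀, v]` it is `< 0`, so the viscous term pushes UP and the derivative is
  `≥ −K·B`; the mean value inequality gives a negative part `≤ K·B·(b − a) ≤ B/2`. Hence
  `B ≤ B/2`, `B = 0`.
Induction over windows of the fixed length `1/(2(K+1))` covers `[0,s]`.

HONEST FRAMING: a statement about Tao-type MODEL lattice ODEs (support item of route OrthantWake,
rung TL-M2Break); nothing here bears on Navier–Stokes regularity, and no summit is proved.
Sources for the TYPE of argument: Kamke quasi-monotonicity / closed-cone invariance for locally
Lipschitz fields; Cheskidov (2008) and Barbato–Morandin–Romito (2011) positivity for the scalar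
dyadic model.
-/

noncomputable section

-- the sub-problem namespace `NavierStokesRegularity.NavierStokesRegularity` is the tree's layout (D-0017)
set_option linter.dupNamespace false

namespace Summit.NavierStokesRegularity.NavierStokesRegularity.Theorems

open Set
open scoped Topology
open Literature.Analysis.FluidPDE.TaoCascade

/-- Coordinates of a shift `μ ∈ S = {(0,0,0),(1,0,0),(0,1,0),(0,0,1)}` are in `{0,1}`; the four
inequalities used below. [this file] -/
theorem orthantInvariance_shiftSet_bounds {μ : ℤ × ℤ × ℤ} (hμ : μ ∈ shiftSet) :
    0 ≤ μ.1 ∧ 0 ≤ μ.2.1 ∧ 0 ≤ μ.2.2 ∧ μ.2.2 ≤ 1 := by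
  rcases (mem_shiftSet_iff μ).1 hμ with rfl | rfl | rfl | rfl <;> simp

/-- Weight bookkeeping: for a mode `x` on a shell `l ≥ k − 1` obeying the a priori bound
`(1 + (1+ε₀)^{10 l}) |x| ≤ M`, and an exponent `e ≤ 5k/2` (`k ≥ 1`),
`(1+ε₀)^e |x| ≤ (1+ε₀)^{10} M`. [this file] -/
theorem orthantInvariance_weight_le {ε₀ M e x : ℝ} (hε : 0 < ε₀) {k l : ℤ} (hk : 1 ≤ k)
    (hl : k - 1 ≤ l) (he : e ≤ 5 * (k : ℝ) / 2)
    (hx : (1 + (1 + ε₀) ^ ((10 : ℝ) * l)) * |x| ≤ M) :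
    (1 + ε₀) ^ e * |x| ≤ (1 + ε₀) ^ (10 : ℝ) * M := by
  have h1 : (1 : ℝ) ≤ 1 + ε₀ := by linarith
  have h0 : (0 : ℝ) < 1 + ε₀ := by linarith
  have hk' : (1 : ℝ) ≤ k := by exact_mod_cast hk
  have hl' : ((k - 1 : ℤ) : ℝ) ≤ (l : ℝ) := Int.cast_le.2 hl
  push_cast at hl'
  have step1 : (1 + ε₀) ^ e ≤ (1 + ε₀) ^ (10 : ℝ) * (1 + ε₀) ^ ((10 : ℝ) * l) := by
    calc (1 + ε₀) ^ e ≤ (1 + ε₀) ^ ((10 : ℝ) + (10 : ℝ) * ((k : ℝ) - 1)) :=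
          Real.rpow_le_rpow_of_exponent_le h1 (by linarith)
      _ = (1 + ε₀) ^ (10 : ℝ) * (1 + ε₀) ^ ((10 : ℝ) * ((k : ℝ) - 1)) := Real.rpow_add h0 _ _
      _ ≤ (1 + ε₀) ^ (10 : ℝ) * (1 + ε₀) ^ ((10 : ℝ) * l) :=
          mul_le_mul_of_nonneg_left (Real.rpow_le_rpow_of_exponent_le h1 (by linarith))
            (Real.rpow_nonneg h0.le _)
  have hpos10 : 0 ≤ (1 + ε₀) ^ (10 : ℝ) := Real.rpow_nonneg h0.le _
  have hposl : 0 ≤ (1 + ε₀) ^ ((10 : ℝ) * l) := Real.rpow_nonneg h0.le _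
  calc (1 + ε₀) ^ e * |x| ≤ ((1 + ε₀) ^ (10 : ℝ) * (1 + ε₀) ^ ((10 : ℝ) * l)) * |x| :=
        mul_le_mul_of_nonneg_right step1 (abs_nonneg x)
    _ = (1 + ε₀) ^ (10 : ℝ) * ((1 + ε₀) ^ ((10 : ℝ) * l) * |x|) := by ring
    _ ≤ (1 + ε₀) ^ (10 : ℝ) * ((1 + (1 + ε₀) ^ ((10 : ℝ) * l)) * |x|) := by
        refine mul_le_mul_of_nonneg_left ?_ hpos10
        exact mul_le_mul_of_nonneg_right (by linarith) (abs_nonneg x)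
    _ ≤ (1 + ε₀) ^ (10 : ℝ) * M := mul_le_mul_of_nonneg_left hx hpos10

/-- Elementary bilinear perturbation bound: `|a c (z_a z_b) − a c (y_a y_b)| ≤ |a|·(2 P B)` when
`|z_a − y_a|, |z_b − y_b| ≤ B` and `c |z_b|, c |y_a| ≤ P` (`c, B ≥ 0`). [this file] -/
theorem orthantInvariance_prod_bound {a c za zb ya yb B P : ℝ} (hc : 0 ≤ c) (hB : 0 ≤ B)
    (hda : |za - ya| ≤ B) (hdb : |zb - yb| ≤ B) (hzb : c * |zb| ≤ P) (hya : c * |ya| ≤ P) :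
    |a * c * (za * zb) - a * c * (ya * yb)| ≤ |a| * (2 * P * B) := by
  have hP : 0 ≤ P := le_trans (mul_nonneg hc (abs_nonneg _)) hzb
  have h1 : a * c * (za * zb) - a * c * (ya * yb) =
      a * (c * ((za - ya) * zb + ya * (zb - yb))) := by ring
  rw [h1, abs_mul]
  refine mul_le_mul_of_nonneg_left ?_ (abs_nonneg a)
  rw [abs_mul, abs_of_nonneg hc]
  calc c * |(za - ya) * zb + ya * (zb - yb)|
      ≤ c * (|za - ya| * |zb| + |ya| * |zb - yb|) := by
        refine mul_le_mul_of_nonneg_left ?_ hc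
        calc |(za - ya) * zb + ya * (zb - yb)| ≤ |(za - ya) * zb| + |ya * (zb - yb)| :=
              abs_add_le _ _
          _ = |za - ya| * |zb| + |ya| * |zb - yb| := by rw [abs_mul, abs_mul]
    _ = |za - ya| * (c * |zb|) + (c * |ya|) * |zb - yb| := by ring
    _ ≤ B * P + P * B :=
        add_le_add (mul_le_mul hda hzb (mul_nonneg hc (abs_nonneg _)) hB)
          (mul_le_mul hya hdb (abs_nonneg _) hP)
    _ = 2 * P * B := by ring

/-- **Lipschitz-type lower bound for the cascade nonlinearity of a Kamke (orthant) table.** If the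
table `α` is quasi-positive on the cone `{Y ≥ 0 on shells ≥ 1}`, the configuration `Z(·, ·, v)`
obeys the a priori weight bound with constant `M`, its negative parts on shells `≥ 1` are `≤ B`,
and `Z_{i,k}(v) ≤ 0` for some `k ≥ 1`, then `quadTerm ε₀ α Z i k v ≥ −K B` for every
`K ≥ (Σ|α|)·2·(1+ε₀)^{10}·M` — a constant independent of the shell `k`. [this file] -/
theorem orthantInvariance_quadTerm_lower {ε₀ M B K : ℝ} (hε : 0 < ε₀)
    {α : Fin 4 → Fin 4 → Fin 4 → ℤ × ℤ × ℤ → ℝ}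
    (hK : ∀ (Y : Fin 4 → ℤ → ℝ → ℝ) (τ : ℝ), (∀ (j : Fin 4) (k : ℤ), 1 ≤ k → 0 ≤ Y j k τ) →
      ∀ δ : ℝ, 0 < δ → ∀ (i : Fin 4) (n : ℤ), 1 ≤ n → Y i n τ = 0 → 0 ≤ quadTerm δ α Y i n τ)
    {Z : Fin 4 → ℤ → ℝ → ℝ} {v : ℝ}
    (hM : ∀ (j : Fin 4) (l : ℤ), (1 + (1 + ε₀) ^ ((10 : ℝ) * l)) * |Z j l v| ≤ M)
    (hB0 : 0 ≤ B) (hB : ∀ (j : Fin 4) (l : ℤ), 1 ≤ l → -B ≤ Z j l v)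
    (hKA : (∑ i₁ : Fin 4, ∑ i₂ : Fin 4, ∑ i₃ : Fin 4, ∑ μ ∈ shiftSet, |α i₁ i₂ i₃ μ|) *
      (2 * ((1 + ε₀) ^ (10 : ℝ) * M)) ≤ K)
    {i : Fin 4} {k : ℤ} (hk : 1 ≤ k) (hZ : Z i k v ≤ 0) :
    -(K * B) ≤ quadTerm ε₀ α Z i k v := by
  have h0 : (0 : ℝ) < 1 + ε₀ := by linarith
  have hM0 : 0 ≤ M :=
    le_trans (mul_nonneg (add_nonneg zero_le_one (Real.rpow_nonneg h0.le _)) (abs_nonneg _))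
      (hM i k)
  -- the projection of `Z` onto the cone
  set Y : Fin 4 → ℤ → ℝ → ℝ := fun j l τ => if 1 ≤ l then max (Z j l τ) 0 else Z j l τ
    with hYdef
  have hYnn : ∀ (j : Fin 4) (l : ℤ), 1 ≤ l → 0 ≤ Y j l v := by
    intro j l hl
    simp only [hYdef, if_pos hl]
    exact le_max_right _ _
  have hYik : Y i k v = 0 := by
    simp only [hYdef, if_pos hk]
    exact max_eq_right hZ
  have hKY : 0 ≤ quadTerm ε₀ α Y i k v := hK Y v hYnn ε₀ hε i k hk hYik
  have hdiff : ∀ (j : Fin 4) (l : ℤ), |Z j l v - Y j l v| ≤ B := by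
    intro j l
    by_cases hl : 1 ≤ l
    · simp only [hYdef, if_pos hl]
      rcases le_total (Z j l v) 0 with h | h
      · rw [max_eq_right h, sub_zero, abs_of_nonpos h]
        linarith [hB j l hl]
      · rw [max_eq_left h, sub_self, abs_zero]
        exact hB0
    · simp only [hYdef, if_neg hl, sub_self, abs_zero]
      exact hB0
  have habsY : ∀ (j : Fin 4) (l : ℤ), |Y j l v| ≤ |Z j l v| := by
    intro j l
    by_cases hl : 1 ≤ l
    · simp only [hYdef, if_pos hl]
      rcases le_total (Z j l v) 0 with h | h
      · rw [max_eq_right h, abs_zero]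
        exact abs_nonneg _
      · rw [max_eq_left h]
    · simp only [hYdef, if_neg hl]
      exact le_rfl
  -- the difference of the two nonlinearities, term by term
  have habs : |quadTerm ε₀ α Z i k v - quadTerm ε₀ α Y i k v| ≤
      (∑ i₁ : Fin 4, ∑ i₂ : Fin 4, ∑ i₃ : Fin 4, ∑ μ ∈ shiftSet, |α i₁ i₂ i₃ μ|) *
        (2 * ((1 + ε₀) ^ (10 : ℝ) * M) * B) := by
    unfold quadTerm
    simp only [← Finset.sum_sub_distrib]
    refine (Finset.abs_sum_le_sum_abs _ _).trans ?_
    refine (Finset.sum_le_sum fun i₁ _ => Finset.abs_sum_le_sum_abs _ _).trans ?_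
    refine (Finset.sum_le_sum fun i₁ _ => Finset.sum_le_sum fun i₂ _ =>
      Finset.abs_sum_le_sum_abs _ _).trans ?_
    calc _ ≤ ∑ i₁ : Fin 4, ∑ i₂ : Fin 4, ∑ μ ∈ shiftSet,
          |α i₁ i₂ i μ| * (2 * ((1 + ε₀) ^ (10 : ℝ) * M) * B) := by
          refine Finset.sum_le_sum fun i₁ _ => Finset.sum_le_sum fun i₂ _ =>
            Finset.sum_le_sum fun μ hμ => ?_
          obtain ⟨hμ1, hμ2, hμ3, hμ3'⟩ := orthantInvariance_shiftSet_bounds hμ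
          have hμ3r : (0 : ℝ) ≤ (μ.2.2 : ℝ) := by exact_mod_cast hμ3
          have he : (5 : ℝ) * (k - μ.2.2) / 2 ≤ 5 * (k : ℝ) / 2 := by linarith
          have hla : k - 1 ≤ k - μ.2.2 + μ.1 := by omega
          have hlb : k - 1 ≤ k - μ.2.2 + μ.2.1 := by omega
          refine orthantInvariance_prod_bound (Real.rpow_nonneg h0.le _) hB0 (hdiff _ _)
            (hdiff _ _) ?_ ?_
          · exact orthantInvariance_weight_le hε hk hlb he (hM _ _)
          · exact (mul_le_mul_of_nonneg_left (habsY _ _) (Real.rpow_nonneg h0.le _)).trans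
              (orthantInvariance_weight_le hε hk hla he (hM _ _))
      _ = (∑ i₁ : Fin 4, ∑ i₂ : Fin 4, ∑ μ ∈ shiftSet, |α i₁ i₂ i μ|) *
            (2 * ((1 + ε₀) ^ (10 : ℝ) * M) * B) := by
          simp only [Finset.sum_mul]
      _ ≤ (∑ i₁ : Fin 4, ∑ i₂ : Fin 4, ∑ i₃ : Fin 4, ∑ μ ∈ shiftSet, |α i₁ i₂ i₃ μ|) *
            (2 * ((1 + ε₀) ^ (10 : ℝ) * M) * B) := by
          refine mul_le_mul_of_nonneg_right ?_
            (mul_nonneg (mul_nonneg zero_le_two (mul_nonneg (Real.rpow_nonneg h0.le _) hM0)) hB0)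
          refine Finset.sum_le_sum fun i₁ _ => Finset.sum_le_sum fun i₂ _ => ?_
          exact Finset.single_le_sum (f := fun i₃ => ∑ μ ∈ shiftSet, |α i₁ i₂ i₃ μ|)
            (fun i₃ _ => Finset.sum_nonneg fun μ _ => abs_nonneg _) (Finset.mem_univ i)
  have h1 := (abs_sub_le_iff.1 habs).2
  have h2 : (∑ i₁ : Fin 4, ∑ i₂ : Fin 4, ∑ i₃ : Fin 4, ∑ μ ∈ shiftSet, |α i₁ i₂ i₃ μ|) *
      (2 * ((1 + ε₀) ^ (10 : ℝ) * M) * B) ≤ K * B := by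
    rw [show (∑ i₁ : Fin 4, ∑ i₂ : Fin 4, ∑ i₃ : Fin 4, ∑ μ ∈ shiftSet, |α i₁ i₂ i₃ μ|) *
        (2 * ((1 + ε₀) ^ (10 : ℝ) * M) * B) =
        ((∑ i₁ : Fin 4, ∑ i₂ : Fin 4, ∑ i₃ : Fin 4, ∑ μ ∈ shiftSet, |α i₁ i₂ i₃ μ|) *
          (2 * ((1 + ε₀) ^ (10 : ℝ) * M))) * B by ring]
    exact mul_le_mul_of_nonneg_right hKA hB0
  linarith

/-- **Window step of the Kamke argument.** On a window `[a,b] ⊆ [0,s]` with `K (b − a) ≤ ½`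
that starts in the cone (`X(a) ≥ 0` on shells `≥ 1`), a continuous solution of the viscous
lattice with the a priori bound and the Lipschitz-type lower bound `quadTerm ≥ −K B` (whenever
negative parts are `≤ B` and the mode is `≤ 0`) stays in the cone on the whole window: the
supremum `B` of the negative parts over the window satisfies `B ≤ B/2`. [this file] -/
theorem orthantInvariance_window {ε₀ ν K s a b M : ℝ} (hν : 0 < ν) (hε : 0 < ε₀) (hK0 : 0 ≤ K)
    {α : Fin 4 → Fin 4 → Fin 4 → ℤ × ℤ × ℤ → ℝ} {X : Fin 4 → ℤ → ℝ → ℝ}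
    (hM : ∀ (t : ℝ) (i : Fin 4) (k : ℤ), (1 + (1 + ε₀) ^ ((10 : ℝ) * k)) * |X i k t| ≤ M)
    (hcont : ∀ (i : Fin 4) (k : ℤ), Continuous (X i k))
    (hODE : ∀ (i : Fin 4) (k : ℤ), ∀ t ∈ Icc (0 : ℝ) s, HasDerivWithinAt (X i k)
      (quadTerm ε₀ α X i k t - ν * (1 + ε₀) ^ ((2 : ℝ) * k) * X i k t) (Icc (0 : ℝ) s) t)
    (hkey : ∀ v ∈ Icc a b, ∀ B : ℝ, 0 ≤ B → (∀ (j : Fin 4) (l : ℤ), 1 ≤ l → -B ≤ X j l v) →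
      ∀ (i : Fin 4) (k : ℤ), 1 ≤ k → X i k v ≤ 0 → -(K * B) ≤ quadTerm ε₀ α X i k v)
    (ha : 0 ≤ a) (hab : a ≤ b) (hbs : b ≤ s) (hlen : K * (b - a) ≤ 1 / 2)
    (hprev : ∀ (i : Fin 4) (k : ℤ), 1 ≤ k → 0 ≤ X i k a) :
    ∀ u ∈ Icc a b, ∀ (i : Fin 4) (k : ℤ), 1 ≤ k → 0 ≤ X i k u := by
  have h0 : (0 : ℝ) < 1 + ε₀ := by linarith
  have habsM : ∀ (t : ℝ) (i : Fin 4) (k : ℤ), |X i k t| ≤ M := by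
    intro t i k
    have h1 : (1 : ℝ) ≤ 1 + (1 + ε₀) ^ ((10 : ℝ) * k) :=
      le_add_of_nonneg_right (Real.rpow_nonneg h0.le _)
    calc |X i k t| = 1 * |X i k t| := (one_mul _).symm
      _ ≤ (1 + (1 + ε₀) ^ ((10 : ℝ) * k)) * |X i k t| :=
          mul_le_mul_of_nonneg_right h1 (abs_nonneg _)
      _ ≤ M := hM t i k
  -- the supremum of the negative parts over the window
  set S : Set ℝ := {r | ∃ (j : Fin 4) (l : ℤ) (v : ℝ), 1 ≤ l ∧ v ∈ Icc a b ∧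
    r = max (-X j l v) 0} with hSdef
  have hSne : S.Nonempty := ⟨_, 0, 1, a, le_rfl, ⟨le_rfl, hab⟩, rfl⟩
  have hSbdd : BddAbove S := by
    refine ⟨max M 0, ?_⟩
    rintro r ⟨j, l, v, _, _, rfl⟩
    exact max_le_max ((neg_le_abs _).trans (habsM v j l)) le_rfl
  set B : ℝ := sSup S with hBdef
  have hBge : ∀ (j : Fin 4) (l : ℤ) (v : ℝ), 1 ≤ l → v ∈ Icc a b → max (-X j l v) 0 ≤ B :=
    fun j l v hl hv => le_csSup hSbdd ⟨j, l, v, hl, hv, rfl⟩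
  have hB0 : 0 ≤ B := (le_max_right _ _).trans (hBge 0 1 a le_rfl ⟨le_rfl, hab⟩)
  have hBge' : ∀ v ∈ Icc a b, ∀ (j : Fin 4) (l : ℤ), 1 ≤ l → -B ≤ X j l v := by
    intro v hv j l hl
    have := (le_max_left _ _).trans (hBge j l v hl hv)
    linarith
  -- every negative part on the window is at most `B / 2`
  have hhalf : ∀ (j : Fin 4) (l : ℤ) (v : ℝ), 1 ≤ l → v ∈ Icc a b →
      max (-X j l v) 0 ≤ B / 2 := by
    intro j l v hl hv
    refine max_le ?_ (by linarith)
    by_cases hx : 0 ≤ X j l v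
    · linarith
    push Not at hx
    -- the last time in `[a, v]` at which the mode was `≥ 0`
    set T0 : Set ℝ := Icc a v ∩ (X j l) ⁻¹' (Ici 0) with hT0def
    have hT0ne : T0.Nonempty := ⟨a, ⟨le_rfl, hv.1⟩, (hprev j l hl : (0 : ℝ) ≤ X j l a)⟩
    have hT0bdd : BddAbove T0 := ⟨v, fun w hw => hw.1.2⟩
    have hT0cl : IsClosed T0 := isClosed_Icc.inter (isClosed_Ici.preimage (hcont j l))
    have hmem := hT0cl.csSup_mem hT0ne hT0bdd
    set t₀ : ℝ := sSup T0 with ht₀def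
    obtain ⟨⟨hat₀, ht₀v⟩, ht₀X⟩ := hmem
    have ht₀X' : 0 ≤ X j l t₀ := ht₀X
    have ht₀lt : t₀ < v := lt_of_le_of_ne ht₀v (fun h => by rw [h] at ht₀X'; linarith)
    have hafter : ∀ w : ℝ, t₀ < w → w ≤ v → X j l w < 0 := by
      intro w hw1 hw2
      by_contra hge
      push Not at hge
      have : w ≤ t₀ := le_csSup hT0bdd ⟨⟨hat₀.trans hw1.le, hw2⟩, hge⟩
      linarith
    -- derivative lower bound on `(t₀, v)`
    have hderiv : ∀ x ∈ interior (Icc t₀ v), -(K * B) ≤ deriv (X j l) x := by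
      intro x hx
      rw [interior_Icc] at hx
      have hx0s : x ∈ Icc (0 : ℝ) s := ⟨by linarith [hx.1], by linarith [hx.2, hv.2]⟩
      have hnhds : Icc (0 : ℝ) s ∈ 𝓝 x :=
        Icc_mem_nhds (by linarith [hx.1]) (by linarith [hx.2, hv.2])
      have hd := (hODE j l x hx0s).hasDerivAt hnhds
      rw [hd.deriv]
      have hxab : x ∈ Icc a b := ⟨by linarith [hx.1], by linarith [hx.2, hv.2]⟩
      have hneg : X j l x < 0 := hafter x hx.1 hx.2.le
      have hq := hkey x hxab B hB0 (hBge' x hxab) j l hl hneg.le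
      have hc : 0 < ν * (1 + ε₀) ^ ((2 : ℝ) * l) := mul_pos hν (Real.rpow_pos_of_pos h0 _)
      have hvisc := mul_neg_of_pos_of_neg hc hneg
      linarith
    have hcont' : ContinuousOn (X j l) (Icc t₀ v) := (hcont j l).continuousOn
    have hdiff' : DifferentiableOn ℝ (X j l) (interior (Icc t₀ v)) := by
      intro x hx
      rw [interior_Icc] at hx
      have hx0s : x ∈ Icc (0 : ℝ) s := ⟨by linarith [hx.1], by linarith [hx.2, hv.2]⟩
      have hnhds : Icc (0 : ℝ) s ∈ 𝓝 x :=
        Icc_mem_nhds (by linarith [hx.1]) (by linarith [hx.2, hv.2])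
      exact ((hODE j l x hx0s).hasDerivAt hnhds).differentiableAt.differentiableWithinAt
    have hmv := (convex_Icc t₀ v).mul_sub_le_image_sub_of_le_deriv hcont' hdiff' hderiv
      t₀ (left_mem_Icc.2 ht₀v) v (right_mem_Icc.2 ht₀v) ht₀v
    have hvt : v - t₀ ≤ b - a := by linarith [hv.2]
    have h3 : K * B * (v - t₀) ≤ K * B * (b - a) :=
      mul_le_mul_of_nonneg_left hvt (mul_nonneg hK0 hB0)
    have h4 : K * B * (b - a) ≤ B / 2 := by
      calc K * B * (b - a) = B * (K * (b - a)) := by ring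
        _ ≤ B * (1 / 2) := mul_le_mul_of_nonneg_left hlen hB0
        _ = B / 2 := by ring
    linarith
  have hBle : B ≤ B / 2 := by
    refine csSup_le hSne ?_
    rintro r ⟨j, l, v, hl, hv, rfl⟩
    exact hhalf j l v hl hv
  have hB00 : B ≤ 0 := by linarith
  intro u hu i k hk
  have := (le_max_left _ _).trans (hBge i k u hk hu)
  linarith

/-- **Item stmt-NavierStokesRegularity-24642** (`OrthantWake.OrthantInvariance`): Kamke cone
invariance — a regular solution of the `ν`-viscous lattice of an orthant (quasi-positive) table
from a one-shell datum at shell `0` is componentwise `≥ 0` on every shell `k ≥ 1` throughout its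
window. MODEL lattice statement; no Navier–Stokes statement is proved. [this file] -/
theorem orthantInvariance_proof :
    Summit.NavierStokesRegularity.NavierStokesRegularity.Theses.OrthantWake.OrthantInvariance := by
  unfold Summit.NavierStokesRegularity.NavierStokesRegularity.Theses.OrthantWake.OrthantInvariance
  intro ε₀ ν hε hν α hK X₀ s _hs X hinit _hlow hbd hcont hODE
  obtain ⟨M, hM⟩ := hbd
  have h0 : (0 : ℝ) < 1 + ε₀ := by linarith
  have hM0 : 0 ≤ M :=
    le_trans (mul_nonneg (add_nonneg zero_le_one (Real.rpow_nonneg h0.le _)) (abs_nonneg _))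
      (hM 0 0 0)
  obtain ⟨K, hKdef⟩ : ∃ K : ℝ, K = (∑ i₁ : Fin 4, ∑ i₂ : Fin 4, ∑ i₃ : Fin 4,
      ∑ μ ∈ shiftSet, |α i₁ i₂ i₃ μ|) * (2 * ((1 + ε₀) ^ (10 : ℝ) * M)) := ⟨_, rfl⟩
  have hA0 : 0 ≤ ∑ i₁ : Fin 4, ∑ i₂ : Fin 4, ∑ i₃ : Fin 4, ∑ μ ∈ shiftSet, |α i₁ i₂ i₃ μ| :=
    Finset.sum_nonneg fun _ _ => Finset.sum_nonneg fun _ _ => Finset.sum_nonneg fun _ _ =>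
      Finset.sum_nonneg fun _ _ => abs_nonneg _
  have hK0 : 0 ≤ K := by
    rw [hKdef]
    exact mul_nonneg hA0 (mul_nonneg zero_le_two (mul_nonneg (Real.rpow_nonneg h0.le _) hM0))
  -- the Lipschitz-type lower bound, at every time
  have hkey : ∀ (v B : ℝ), 0 ≤ B → (∀ (j : Fin 4) (l : ℤ), 1 ≤ l → -B ≤ X j l v) →
      ∀ (i : Fin 4) (k : ℤ), 1 ≤ k → X i k v ≤ 0 → -(K * B) ≤ quadTerm ε₀ α X i k v :=
    fun v B hB0 hB i k hk hx =>
      orthantInvariance_quadTerm_lower hε hK (fun j l => hM v j l) hB0 hB hKdef.symm.le hk hx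
  -- windows of the fixed length `δ₀`
  have hK1 : 0 < K + 1 := by linarith
  obtain ⟨δ₀, hδ₀def⟩ : ∃ δ₀ : ℝ, δ₀ = 1 / (2 * (K + 1)) := ⟨_, rfl⟩
  have hδ₀pos : 0 < δ₀ := by rw [hδ₀def]; positivity
  have hlen : K * δ₀ ≤ 1 / 2 := by
    rw [hδ₀def, ← mul_div_assoc, mul_one, div_le_iff₀ (by positivity)]
    linarith
  have claim : ∀ n : ℕ, ∀ u ∈ Icc (0 : ℝ) s, u ≤ n * δ₀ →
      ∀ (i : Fin 4) (k : ℤ), 1 ≤ k → 0 ≤ X i k u := by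
    intro n
    induction n with
    | zero =>
      intro u hu hu0 i k hk
      have hu00 : u = 0 := le_antisymm (by simpa using hu0) hu.1
      have hk0 : k ≠ 0 := by omega
      simp only [hu00, hinit i k, if_neg hk0, le_refl]
    | succ n ih =>
      intro u hu hun i k hk
      by_cases hcase : u ≤ n * δ₀
      · exact ih u hu hcase i k hk
      push Not at hcase
      push_cast at hun
      have hsucc : ((n : ℝ) + 1) * δ₀ = n * δ₀ + δ₀ := by ring
      have hna : (0 : ℝ) ≤ n * δ₀ := by positivity
      have hns : (n : ℝ) * δ₀ ≤ s := by linarith [hu.2]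
      have hab : (n : ℝ) * δ₀ ≤ min (((n : ℝ) + 1) * δ₀) s := le_min (by linarith) hns
      have hbs : min (((n : ℝ) + 1) * δ₀) s ≤ s := min_le_right _ _
      have hlen' : K * (min (((n : ℝ) + 1) * δ₀) s - n * δ₀) ≤ 1 / 2 := by
        have h5 : min (((n : ℝ) + 1) * δ₀) s - n * δ₀ ≤ δ₀ := by
          have := min_le_left (((n : ℝ) + 1) * δ₀) s
          linarith
        exact (mul_le_mul_of_nonneg_left h5 hK0).trans hlen
      have hprev : ∀ (i : Fin 4) (k : ℤ), 1 ≤ k → 0 ≤ X i k (n * δ₀) :=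
        fun i k hk => ih (n * δ₀) ⟨hna, hns⟩ le_rfl i k hk
      have hub : u ∈ Icc ((n : ℝ) * δ₀) (min (((n : ℝ) + 1) * δ₀) s) :=
        ⟨hcase.le, le_min hun hu.2⟩
      exact orthantInvariance_window hν hε hK0 hM hcont hODE (fun v _ => hkey v) hna hab hbs
        hlen' hprev u hub i k hk
  intro t ht i k hk
  obtain ⟨n, hn⟩ := exists_nat_ge (t / δ₀)
  exact claim n t ht ((div_le_iff₀ hδ₀pos).1 hn) i k hk

end Summit.NavierStokesRegularity.NavierStokesRegularity.Theorems

end
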